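import Summits.PneNP.PneNP.Theorems.PeaTwoMemBPP.Negative.CensusDoesNotDetermineEntropy

/-!
# PneNP / SzkEntropy — crux `PeaTwoMemBPP` (stmt-PneNP-10778), negative side: Shannon vs Rényi, and the signed one-step degree reduction

Route `PneNP/SzkEntropy`, crux stmt-PneNP-10778: `PEA 2 ∈ PromiseBPP'`.  Two further checked facts from
the standing disprover's file (`Cruxes/PeaTwoMemBPP/Disproof.lean`, §5–§6), building on the entropy
bridge of `CensusDoesNotDetermineEntropy.lean`:

* §5 `entropy_renyiFamily7`, `collisionCount_renyiFamily7`: the quadratic map (x₀, x₀x₁, …, x₀x₆) has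
  Shannon entropy EXACTLY 4 and collision count 4160 (Rényi-2 entropy 14 − log₂ 4160 < 2): it lies
  outside both sides of the promise of DGRV's only printed algorithm (Thm 5.3: 'H_Shannon < k vs
  H_Rényi ≥ 2k+1'), and in the family H = (m+1)/2 → ∞ while H₂ < 2 — Rényi-type statistics cannot
  approximate the Shannon entropy of quadratic maps over F₂ to any additive constant.
* §6 `gadget_identity_x012`, `gadget_identity_x012_entropy`: for the cubic monomial p = x₀x₁x₂, eight
  explicit QUADRATIC maps q_u (u the 7 nonzero linear forms in x₀,x₁,x₂; one fresh variable each) and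
  q_W (three fresh variables) satisfy the exact identity
      H(p) = ⅓ Σ_u H(q_u) − (4/3) H(q_W) + 5/3   (integer form Π(p)⁶ Π(q_W) = ∏_u Π(q_u)),
  the n = 3 instance of the general signed one-step degree reduction (REMARK 6.1; its identity (1)
  is now PROVED IN GENERAL as `entropy_gadget`, via the tagged-mixture rule `mapEntropy_tagged`):
  one cubic monomial occurrence is eliminated EXACTLY at the cost of 8 maps and signed coefficients of
  ℓ₁-mass 11/3; consequently `PEA 2 ∈ prBPP ⇒` PEA₃ restricted to maps with O(log n) cubic monomial
  occurrences is in prBPP (REMARK 6.2), while a sign-free gadget (a Karp reduction PEA₃ ≤ PEA₂, which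
  would make the crux equivalent to the route's kill switch) remains open.

Finite evaluations by `native_decide` (computational).  References: Z. Dvir, D. Gutfreund,
G. N. Rothblum, S. Vadhan, *On approximating the entropy of polynomial mappings*, ICS 2011 (ECCC
TR10-160), Thm 5.3, Claim 5.6; Y. Ishai, E. Kushilevitz, *Randomizing polynomials*, FOCS 2000, §5
(degree-3 vs degree-2 encodings).
-/

namespace Summit.PneNP.PneNP.Theorems.PeaTwoMemBPP.Negative

open Literature.Computability.Complexity Literature.InformationTheory.Entropy
open PolyMapF2

variable {n : ℕ}

/-! ## §5 Shannon versus Rényi entropy for quadratic maps over F₂ -/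

/-- The planner's family `(x₀, x₀x₁, …, x₀x_{m-1})` on `n = m` variables, here `m = 7`. -/
def renyiFamily7 : PolyMapF2 7 :=
  [[[0]], [[0, 1]], [[0, 2]], [[0, 3]], [[0, 4]], [[0, 5]], [[0, 6]]]

/-- Collision count `#{(x, x') : P x = P x'} = Σ_x |fibre(x)| = 2^{2n} · 2^{-H₂(P(U_n))}`. -/
def collisionCount (P : PolyMapF2 n) : ℕ :=
  ∑ x : Fin n → ZMod 2, (fiber Finset.univ P.eval (P.eval x)).card

/-- The family member is quadratic. [folklore] -/
theorem renyiFamily7_degLE : renyiFamily7.DegLE 2 := by decide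
/-- `Π = 2^384` (64 points with fibre 64, 64 singletons). [folklore] -/
theorem fiberProd_renyiFamily7 : fiberProd renyiFamily7 = 2 ^ 384 := by native_decide
/-- `H(renyiFamily7) = 4` exactly (= (m+1)/2 at m = 7). -/
theorem entropy_renyiFamily7 : renyiFamily7.entropy = 4 := by
  rw [entropy_of_fiberProd_eq_two_pow fiberProd_renyiFamily7]; norm_num
/-- Collision count `4160 = 2^14 · (1/4 + 2^{-8})`, i.e. `H₂ = 14 − log₂ 4160 = 1.977… < 2 < H/2`:
the instance lies outside BOTH sides of DGRV's promise 'H_Shannon < k vs H_Rényi ≥ 2k+1' for every k,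
and in the family `H = (m+1)/2 → ∞` while `H₂ ↑ 2` — Rényi-type statistics (directional-derivative
ranks, second moments of biases) cannot approximate Shannon entropy of quadratic maps over F₂ to any
additive constant. [DGRV 2010, Thm 5.3, Claim 5.6] -/
theorem collisionCount_renyiFamily7 : collisionCount renyiFamily7 = 4160 := by native_decide

/-! ## §6 Signed one-step degree reduction: eliminating a cubic monomial exactly, with signs -/

/-! ### 6.0 The one-step elimination identity (1), proved in general

For `R : PolyMapF2 n` (the map with the cubic occurrence removed), coordinate `i`, variables
`a b c : Fin n`: `pOf R i a b c = R + x_a x_b x_c · e_i`, `p'Of = pOf + x_a · e_i`, and the gadget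
`gadget R i a b c` on `n + 1` variables, QUADRATIC in the treated monomial (fresh variable `0 =: w`;
`x_a · w` added to coordinate `i`, extra output `w + x_b x_c`).  `entropy_gadget`:
`H(gadget) = 1 + (H(pOf) + H(p'Of))/2` — identity (1) of REMARK 6.1 for `u = x_a` (the other six `u`
follow by first rewriting `x_a x_b x_c = u · x_κ + [odd overlap] x_κ`), via the general tagged-mixture
rule `mapEntropy_tagged` and the measure-preserving shear `(x, z) ↦ (z + x_b x_c, x)`. -/

/-- Add the monomial `μ` to coordinate `i` of `P`. [folklore] -/
def addMon (P : PolyMapF2 n) (i : ℕ) (μ : List (Fin n)) : PolyMapF2 n :=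
  P.modify i (fun poly => μ :: poly)

/-- Lift a map on `n` variables to `n+1` variables along `Fin.succ` (the new variable `0` unused). [folklore] -/
def lift (P : PolyMapF2 n) : PolyMapF2 (n + 1) :=
  P.map (List.map (List.map Fin.succ))

/-- The gadget `q_u` for `u = x_a`: `R` lifted, `x_a · w` added to coordinate `i`, and the extra output
`w + x_b x_c` (`w` = variable `0`). [folklore] -/
def gadget (R : PolyMapF2 n) (i : ℕ) (a b c : Fin n) : PolyMapF2 (n + 1) :=
  addMon (lift R) i [a.succ, 0] ++ [[[0], [b.succ, c.succ]]]

/-- `p = R + x_a x_b x_c e_i`. [folklore] -/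
def pOf (R : PolyMapF2 n) (i : ℕ) (a b c : Fin n) : PolyMapF2 n := addMon R i [a, b, c]

/-- `p' = p + x_a e_i`. [folklore] -/
def p'Of (R : PolyMapF2 n) (i : ℕ) (a b c : Fin n) : PolyMapF2 n := addMon (pOf R i a b c) i [a]

/-! ### evaluation lemmas -/

/-- Evaluation of `addMon`: the value of coordinate `i` gains the monomial's value. [folklore] -/
theorem eval_addMon (P : PolyMapF2 n) (i : ℕ) (μ : List (Fin n)) (x : Fin n → ZMod 2) :
    (addMon P i μ).eval x = (P.eval x).modify i (fun t => (μ.map x).prod + t) := by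
  induction P generalizing i with
  | nil => simp [addMon, eval]
  | cons poly P ih =>
    cases i with
    | zero => simp [addMon, eval]
    | succ i =>
      have := ih i
      simp only [addMon, eval, List.map_cons, List.modify_succ_cons] at this ⊢
      exact congrArg _ this

/-- Evaluation of `lift`: the lifted map ignores variable `0`. [folklore] -/
theorem eval_lift (P : PolyMapF2 n) (y : Fin (n + 1) → ZMod 2) :
    (lift P).eval y = P.eval (Fin.tail y) := by
  simp only [lift, eval, List.map_map, Function.comp_def]
  rfl

/-- Evaluation of an appended map is the appended evaluation. [folklore] -/
theorem eval_append (P Q : PolyMapF2 n) (x : Fin n → ZMod 2) :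
    (P ++ Q : PolyMapF2 n).eval x = P.eval x ++ Q.eval x := by
  simp [eval]

/-! ### A general "tagged mixture" entropy rule -/

section Tagged

variable {ι β : Type*} [DecidableEq β]

/-- **Entropy of a tagged mixture over a revealed uniform bit**: for two maps `f 0, f 1 : ι → β` on
the same nonempty sample space `S`, the map `(v, z) ↦ (f z v, z)` on `S × F₂` has entropy
`1 + (H(f 0) + H(f 1))/2` (chain rule: the tag is uniform and revealed).
[CoverThomas2006, Thm 2.2.1 (chain rule)] -/
theorem mapEntropy_tagged {S : Finset ι} (hS : S.Nonempty) (f : ZMod 2 → ι → β) :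
    mapEntropy (S ×ˢ (Finset.univ : Finset (ZMod 2))) (fun p : ι × ZMod 2 => (f p.2 p.1, p.2)) =
      1 + (mapEntropy S (f 0) + mapEntropy S (f 1)) / 2 := by
  classical
  have hScard : (0 : ℝ) < S.card := by exact_mod_cast Finset.card_pos.2 hS
  -- fibres of the tagged map
  have hfib : ∀ p ∈ S ×ˢ (Finset.univ : Finset (ZMod 2)),
      fiber (S ×ˢ (Finset.univ : Finset (ZMod 2))) (fun p : ι × ZMod 2 => (f p.2 p.1, p.2))
          (f p.2 p.1, p.2) = (fiber S (f p.2) (f p.2 p.1)) ×ˢ {p.2} := by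
    intro p _
    ext q
    obtain ⟨v, z⟩ := q
    simp only [mem_fiber, Finset.mem_product, Finset.mem_univ, and_true, Prod.mk.injEq,
      Finset.mem_singleton]
    constructor
    · rintro ⟨hv, hf, rfl⟩
      exact ⟨⟨hv, hf⟩, rfl⟩
    · rintro ⟨⟨hv, hf⟩, rfl⟩
      exact ⟨hv, hf, rfl⟩
  have hcardSU : (((S ×ˢ (Finset.univ : Finset (ZMod 2))).card : ℕ) : ℝ) = 2 * S.card := by
    rw [Finset.card_product, Finset.card_univ, ZMod.card]
    push_cast
    ring
  have hcardF : ∀ p : ι × ZMod 2,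
      ((((fiber S (f p.2) (f p.2 p.1)) ×ˢ ({p.2} : Finset (ZMod 2))).card : ℕ) : ℝ) =
        (fiber S (f p.2) (f p.2 p.1)).card := by
    intro p
    rw [Finset.card_product, Finset.card_singleton, mul_one]
  have hterm : ∀ p ∈ S ×ˢ (Finset.univ : Finset (ZMod 2)),
      Real.logb 2 ((2 * S.card : ℝ) / (fiber S (f p.2) (f p.2 p.1)).card) =
        1 + Real.logb 2 ((S.card : ℝ) / (fiber S (f p.2) (f p.2 p.1)).card) := by
    intro p hp
    have hv : p.1 ∈ S := (Finset.mem_product.1 hp).1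
    have hc : (0 : ℝ) < (fiber S (f p.2) (f p.2 p.1)).card := by
      exact_mod_cast card_fiber_pos (f p.2) hv
    rw [mul_div_assoc, Real.logb_mul two_ne_zero (div_pos hScard hc).ne',
      Real.logb_self_eq_one one_lt_two]
  unfold mapEntropy
  rw [Finset.sum_congr rfl fun p hp => by rw [hfib p hp, hcardF p]]
  simp only [hcardSU]
  rw [Finset.sum_congr rfl hterm, Finset.sum_add_distrib, Finset.sum_const, nsmul_eq_mul, mul_one,
    hcardSU, Finset.sum_product_right,
    show (Finset.univ : Finset (ZMod 2)) = {0, 1} from by decide, Finset.sum_pair (by decide)]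
  field_simp
  try ring

end Tagged

/-! ### The identity -/

/-- `v + v = 0` in `F₂`. [folklore] -/
private theorem add_self_zmod2 (v : ZMod 2) : v + v = 0 := by
  fin_cases v <;> rfl

/-- The shear `(x, z) ↦ cons (z + x_b x_c) x` identifying `F₂ⁿ × F₂` with `F₂^{n+1}`. [folklore] -/
def shear (b c : Fin n) : (Fin n → ZMod 2) × ZMod 2 ≃ (Fin (n + 1) → ZMod 2) where
  toFun p := Fin.cons (p.2 + p.1 b * p.1 c) p.1
  invFun y := (Fin.tail y, y 0 + y b.succ * y c.succ)
  left_inv p := by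
    obtain ⟨x, z⟩ := p
    simp only [Fin.tail_cons, Fin.cons_zero, Fin.cons_succ, Prod.mk.injEq, true_and]
    rw [add_assoc, add_self_zmod2, add_zero]
  right_inv y := by
    show Fin.cons ((y 0 + y b.succ * y c.succ) + Fin.tail y b * Fin.tail y c) (Fin.tail y) = y
    have : (y 0 + y b.succ * y c.succ) + Fin.tail y b * Fin.tail y c = y 0 := by
      simp only [Fin.tail]
      rw [add_assoc, add_self_zmod2, add_zero]
    rw [this, Fin.cons_self_tail]

/-- Unfolding `shear`. [folklore] -/
theorem shear_apply (b c : Fin n) (x : Fin n → ZMod 2) (z : ZMod 2) :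
    shear b c (x, z) = Fin.cons (z + x b * x c) x := rfl

/-- The two perturbations of `R`, indexed by the tag `z`: `p` for `z = 0`, `p'` for `z = 1`. [folklore] -/
def pz (R : PolyMapF2 n) (i : ℕ) (a b c : Fin n) (z : ZMod 2) : PolyMapF2 n :=
  if z = 0 then pOf R i a b c else p'Of R i a b c

/-- Pointwise: on `shear (x, z)` the gadget outputs `p_z(x)` followed by the tag `z`. [folklore] -/
theorem eval_gadget_shear (R : PolyMapF2 n) (i : ℕ) (a b c : Fin n) (x : Fin n → ZMod 2)
    (z : ZMod 2) :
    (gadget R i a b c).eval (shear b c (x, z)) = (pz R i a b c z).eval x ++ [z] := by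
  unfold gadget
  rw [eval_append, eval_addMon, eval_lift, shear_apply, Fin.tail_cons]
  congr 1
  · have hz01 : ∀ z : ZMod 2, z = 0 ∨ z = 1 := by decide
    obtain rfl | rfl := hz01 z
    · show _ = (pz R i a b c 0).eval x
      simp only [pz, if_true, pOf, eval_addMon]
      congr 1
      funext t
      simp only [List.map_cons, List.map_nil, List.prod_cons, List.prod_nil, mul_one, Fin.cons_succ,
        Fin.cons_zero]
      ring
    · show _ = (pz R i a b c 1).eval x
      simp only [pz, one_ne_zero, if_false, p'Of, pOf, eval_addMon, List.modify_modify_eq]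
      congr 1
      funext t
      simp only [Function.comp, List.map_cons, List.map_nil, List.prod_cons, List.prod_nil, mul_one,
        Fin.cons_succ, Fin.cons_zero]
      ring
  · simp only [eval, List.map_cons, List.map_nil, List.prod_cons, List.prod_nil, mul_one,
      List.sum_cons, List.sum_nil, add_zero, Fin.cons_zero, Fin.cons_succ, List.cons.injEq, and_true]
    rw [add_assoc, add_self_zmod2, add_zero]

/-- **The one-step elimination identity (1)**: `H(q_{x_a}) = 1 + (H(p) + H(p + x_a e_i))/2`, for every
rest map `R`, coordinate `i` and variables `a, b, c`. [folklore] -/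
theorem entropy_gadget (R : PolyMapF2 n) (i : ℕ) (a b c : Fin n) :
    (gadget R i a b c).entropy = 1 + ((pOf R i a b c).entropy + (p'Of R i a b c).entropy) / 2 := by
  unfold PolyMapF2.entropy
  rw [← Literature.InformationTheory.Entropy.mapEntropy_univ_comp_equiv (shear b c)]
  have h1 : (gadget R i a b c).eval ∘ (shear b c) =
      (fun l : List (ZMod 2) × ZMod 2 => l.1 ++ [l.2]) ∘
        (fun p : (Fin n → ZMod 2) × ZMod 2 => ((pz R i a b c p.2).eval p.1, p.2)) := by
    funext p
    obtain ⟨x, z⟩ := p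
    simp only [Function.comp_apply, eval_gadget_shear]
  have hinj : ∀ p ∈ (Finset.univ : Finset ((Fin n → ZMod 2) × ZMod 2)),
      ∀ p' ∈ (Finset.univ : Finset ((Fin n → ZMod 2) × ZMod 2)),
      (fun l : List (ZMod 2) × ZMod 2 => l.1 ++ [l.2]) ((pz R i a b c p.2).eval p.1, p.2) =
        (fun l : List (ZMod 2) × ZMod 2 => l.1 ++ [l.2]) ((pz R i a b c p'.2).eval p'.1, p'.2) →
      ((pz R i a b c p.2).eval p.1, p.2) = ((pz R i a b c p'.2).eval p'.1, p'.2) := by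
    intro p _ p' _ h
    obtain ⟨h₁, h₂⟩ := List.append_inj' h rfl
    exact Prod.ext h₁ (by simpa using h₂)
  rw [h1, Literature.InformationTheory.Entropy.mapEntropy_comp_of_injOn _ _ hinj,
    ← Finset.univ_product_univ,
    show (fun p : (Fin n → ZMod 2) × ZMod 2 => ((pz R i a b c p.2).eval p.1, p.2)) =
      (fun p => ((fun z v => (pz R i a b c z).eval v) p.2 p.1, p.2)) from rfl,
    mapEntropy_tagged (f := fun z v => (pz R i a b c z).eval v) Finset.univ_nonempty]
  simp [pz]


/-! REMARK 6.1 (theorem on paper, all steps elementary; instance machine-checked below).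
Let `p : F₂ⁿ → F₂ᵐ` have the cubic monomial `μ = x_a x_b x_c` occurring once in coordinate `i`.
For a nonzero linear form `u ∈ W := ⟨x_a, x_b, x_c⟩` pick a 2-subset `κ ⊂ {a,b,c}` whose complement
variable occurs in `u` (always possible) and put, with ONE fresh variable `w`,
  `q_u := p` with `μ` replaced in coordinate `i` by `u·w + [#(u ∩ κ) odd]·x_κ`, plus the new output
  `w + x_κ`.
Then `(x, w) ↦ (x, z := w + x_κ)` is a bijection of `F₂^{n+1}` under which `q_u = (p(x) + z·u·e_i, z)`,
so   `H(q_u) = 1 + ½·H(p) + ½·H(p + u e_i)`.                                            (1)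
With THREE fresh variables, `q_W := p` with `μ` replaced by `x_a w₁ + x_b w₂ + x_c w₃` plus outputs
`w₁ + x_b x_c, w₂ + x_a x_c, w₃ + x_a x_b` gives `q_W ≅ (p(x) + (z₁x_a + z₂x_b + z₃x_c) e_i, z)`, so
     `H(q_W) = 3 + ⅛ Σ_{v ∈ W} H(p + v e_i)`.                                            (2)
Summing (1) over the 7 nonzero `u` and subtracting (2):
     `H(p) = ⅓ Σ_{u ≠ 0} H(q_u) − (4/3) H(q_W) + 5/3`,                                    (3)
equivalently, with `Π` the fibre product (`H = n − log₂ Π / 2ⁿ`):  `Π(p)⁶ · Π(q_W) = ∏_{u≠0} Π(q_u)`.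
All eight maps have the occurrence of `μ` removed and every other monomial unchanged (degree ≤ 2 in
the fresh variables), so T occurrences are removed by 8^T maps with coefficient ℓ₁-mass (11/3)^T.
(The coefficients (7 × ⅓, −4/3) realise the point evaluation δ₀ on functions `W → ℝ` from uniform
averages over nonzero subspaces — lines and W; using planes instead costs ℓ₁-mass 13.  Uniform
subspace averages containing 0 are all a degree-2 gadget can produce, which is why the signs — hence
a PED-type (difference) rather than PEA-type use of the oracle, and the 8^T blow-up — appear.) -/

/-- The cubic test map `p = (x₀x₁x₂)` on `n = 3`. -/
def cub : PolyMapF2 3 := [[[0, 1, 2]]]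
/-- `q_u` for `u = x₀` (cofactor x₁x₂): `(x₀w, w + x₁x₂)`. -/
def q100 : PolyMapF2 4 := [[[0, 3]], [[3], [1, 2]]]
/-- `u = x₁` (cofactor x₀x₂). -/
def q010 : PolyMapF2 4 := [[[1, 3]], [[3], [0, 2]]]
/-- `u = x₂` (cofactor x₀x₁). -/
def q001 : PolyMapF2 4 := [[[2, 3]], [[3], [0, 1]]]
/-- `u = x₀ + x₁` (cofactor x₁x₂, odd overlap ⇒ correction `+ x₁x₂`). -/
def q110 : PolyMapF2 4 := [[[0, 3], [1, 3], [1, 2]], [[3], [1, 2]]]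
/-- `u = x₀ + x₂` (cofactor x₁x₂, correction `+ x₁x₂`). -/
def q101 : PolyMapF2 4 := [[[0, 3], [2, 3], [1, 2]], [[3], [1, 2]]]
/-- `u = x₁ + x₂` (cofactor x₀x₂, correction `+ x₀x₂`). -/
def q011 : PolyMapF2 4 := [[[1, 3], [2, 3], [0, 2]], [[3], [0, 2]]]
/-- `u = x₀ + x₁ + x₂` (cofactor x₁x₂, even overlap ⇒ no correction). -/
def q111 : PolyMapF2 4 := [[[0, 3], [1, 3], [2, 3]], [[3], [1, 2]]]
/-- `q_W`: `(x₀w₁ + x₁w₂ + x₂w₃, w₁ + x₁x₂, w₂ + x₀x₂, w₃ + x₀x₁)`. -/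
def qW : PolyMapF2 6 := [[[0, 3], [1, 4], [2, 5]], [[3], [1, 2]], [[4], [0, 2]], [[5], [0, 1]]]

/-- The seven `q_u`, indexed. -/
def qu : Fin 7 → PolyMapF2 4 := ![q100, q010, q001, q110, q101, q011, q111]

/-- All eight gadget maps are QUADRATIC. [folklore] -/
theorem gadgets_degLE : (∀ u, (qu u).DegLE 2) ∧ qW.DegLE 2 := by decide

/-- **The signed degree-reduction identity, integer form, for `p = x₀x₁x₂`**:
`Π(p)⁶ · Π(q_W) = ∏_u Π(q_u)` — i.e. `H(x₀x₁x₂) = h(1/8) = ⅓ Σ_u H(q_u) − (4/3) H(q_W) + 5/3` with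
eight QUADRATIC maps. -/
theorem gadget_identity_x012 : fiberProd cub ^ 6 * fiberProd qW = ∏ u, fiberProd (qu u) := by
  native_decide

/-- The same identity read in entropies (an exact real identity for this instance). -/
theorem gadget_identity_x012_entropy :
    cub.entropy = (∑ u, (qu u).entropy) / 3 - 4 / 3 * qW.entropy + 5 / 3 := by
  have ha : (0 : ℝ) < fiberProd cub := by exact_mod_cast fiberProd_pos cub
  have hb : (0 : ℝ) < fiberProd qW := by exact_mod_cast fiberProd_pos qW
  have hc : ∀ u ∈ (Finset.univ : Finset (Fin 7)), (fiberProd (qu u) : ℝ) ≠ 0 := fun u _ => by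
    exact_mod_cast (fiberProd_pos (qu u)).ne'
  have hR : (fiberProd cub : ℝ) ^ 6 * fiberProd qW = ∏ u, (fiberProd (qu u) : ℝ) := by
    exact_mod_cast gadget_identity_x012
  have key : 6 * Real.logb 2 (fiberProd cub) + Real.logb 2 (fiberProd qW) =
      ∑ u, Real.logb 2 (fiberProd (qu u)) := by
    have := congrArg (Real.logb 2) hR
    rwa [Real.logb_mul (pow_ne_zero _ ha.ne') hb.ne', Real.logb_pow, Real.logb_prod _ _ hc] at this
  have hsum : ∑ u, (qu u).entropy = 7 * 4 - (∑ u, Real.logb 2 (fiberProd (qu u))) / 2 ^ 4 := by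
    simp only [entropy_eq_sub_logb_fiberProd, Finset.sum_sub_distrib, Finset.sum_const,
      Finset.card_univ, Fintype.card_fin, nsmul_eq_mul, Finset.sum_div]
    push_cast
    ring
  rw [hsum, entropy_eq_sub_logb_fiberProd, entropy_eq_sub_logb_fiberProd]
  push_cast
  linarith [key]

/-! REMARK 6.2 (consequences).  (i) If `PEA 2 ∈ PromiseBPP'` then entropies of quadratic maps are
approximable to additive `1/t` in randomized time poly(size·t) (query the decider on `q^{×t}` —
`entropy_prod` — for each threshold k and locate the flip), so by (3) iterated, entropies of cubic maps
with T cubic monomial occurrences are approximable in time poly · 8^T · (11/3)^{T}: for every c,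
`PEA₃ ∩ {≤ c log n cubic occurrences} ∈ prBPP`.  Degree-3 hardness (thesis X, DGRV Thm 4.7 via IK
randomizing polynomials, which have poly(n) cubic monomials r·x·r') is untouched, but any proof of X
must use ω(log n) cubic terms in an essential way, and any algorithm for the crux is automatically an
algorithm for "almost quadratic" cubic maps.  (ii) (1) alone says: the average ½H(p) + ½H(p + u eᵢ) over
a linear perturbation of one coordinate is a quadratic-map entropy; a cubic map whose designated linear
factors are also OUTPUT coordinates (p_j = x_a for some j) has `H(p + x_a e_i) = H(p)` (output shear), so
such "transparent" cubic maps Karp-reduce to PEA₂ exactly — but their entropy is `|y| + E_y H(Q_y)`, an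
average of quadratic entropies, so they carry no new hardness.  (iii) Whether a sign-free gadget exists
(a genuine Karp reduction PEA₃ ≤ PEA₂, which would make the crux EQUIVALENT to the kill switch and to
SZK_L ⊆ BPP) is the sharpest open question this file isolates; by IK00/AIK06 no degree-2 perfectly or
statistically private randomized encoding of general functions exists, but entropy preservation is a
strictly weaker requirement than privacy + correctness, so that impossibility does not settle it. -/


end Summit.PneNP.PneNP.Theorems.PeaTwoMemBPP.Negative
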